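import Summits.Parity.GeneralizedHardyLittlewood.Theorems.PrimeLevelFamEdgeIdeaDeltasNegationKill

/-!
# Sketch — crux-ideate 2-g12 on `PrimeLevelFamEdge.MomentsBeyondDiagonal` (stmt-Parity-20007)
# Idea `height-shear-kill` (negation lens): prove the depth-matched KILL, not the crux.

First lemma (PROVED here, pure logic over the route decl): K_A forces TWO-LEVEL AGREEMENT — at any two
large primes the main-term-scaled mollified second moments agree up to the K_A error, because the
beyond-diagonal functional `T₂(Δ',P,Q)` is LEVEL-FREE. The kill line contradicts this in an
(A)-world by comparing two HEIGHTS `q ≍ D^{λ₁}`, `q ≍ D^{λ₂}` inside ONE root-number class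
(`HeightShearAt`), and composes with the tree kernel `theorem1_of_kA_of_deepKill`.
The analytic hinge of the line (level-averaged beyond-diagonal mean value, used only as an UPPER
bound for the lacunary class — legal because the kill quantifies `∃ q`) is typed as `LevelAvgMeanValue`.
No Landau–Siegel statement is proved here; typed ≠ proved.
-/

noncomputable section

open scoped Real
open Complex Finset Polynomial
open Literature.NumberTheory.EllipticCurves.ModularForms
open Literature.NumberTheory.LFunctions
open Literature.NumberTheory.LFunctions.KMV2000
open Summit.Parity.GeneralizedHardyLittlewood.Theses.PrimeLevelFamEdge
open Summit.Parity.GeneralizedHardyLittlewood.Theorems.PrimeLevelFamEdgeIdeaDeltas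
open Summit.Parity.GeneralizedHardyLittlewood.Theorems.PrimeLevelFamEdgeIdeaDeltas.Negation

namespace Summit.Parity.GeneralizedHardyLittlewood.Cruxes.MomentsBeyondDiagonal.HeightShear

/-- The K_A main-term scale of the second moment at level `q`, length exponent `Δ'`:
`2 ζ(2)² q̂ / (Δ'² log² q̂)` (verbatim from `KMV2000.MomentAsymptotics`). -/
def scale (Δ' : ℝ) (q : ℕ) : ℂ :=
  2 * riemannZeta 2 ^ 2 * ((qhat q / (Δ' ^ 2 * Real.log (qhat q) ^ 2) : ℝ) : ℂ)

/-- **Two-level agreement** (cross-multiplied, division-free): for some `Δ > 1`, every admissible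
`P`, even-or-odd `Q`, `Δ' ∈ (1, Δ]`, there are `C, q₀` such that at any two primes `q₁, q₂ ≥ q₀`
(mollifier lengths `q̂ᵢ^{Δ'} ∉ ℕ`) the scaled second moments agree:
`‖Q^h(q₁)·S(q₂) − Q^h(q₂)·S(q₁)‖ ≤ C (q̂₁ log⁻³q̂₁ ‖S(q₂)‖ + q̂₂ log⁻³q̂₂ ‖S(q₁)‖)`.
This is what «`T₂` level-free» MEANS operationally; the kill never needs to know `T₂`. -/
def TwoLevelAgreement : Prop :=
  ∃ Δ : ℝ, 1 < Δ ∧ ∀ P Q : ℝ[X], KMV2000.Admissible P → IsEvenOrOdd Q →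
    ∀ Δ' : ℝ, 1 < Δ' → Δ' ≤ Δ → ∃ C : ℝ, ∃ q₀ : ℕ,
      ∀ (q₁ q₂ : ℕ) [NeZero q₁] [NeZero q₂], q₁.Prime → q₂.Prime → q₀ ≤ q₁ → q₀ ≤ q₂ →
        (∀ n : ℕ, (n : ℝ) ≠ qhat q₁ ^ Δ') → (∀ n : ℕ, (n : ℝ) ≠ qhat q₂ ^ Δ') →
          ‖QhPQ q₁ P Q (qhat q₁ ^ Δ') * scale Δ' q₂ - QhPQ q₂ P Q (qhat q₂ ^ Δ') * scale Δ' q₁‖ ≤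
            C * (qhat q₁ * (Real.log (qhat q₁))⁻¹ ^ 3 * ‖scale Δ' q₂‖ +
                 qhat q₂ * (Real.log (qhat q₂))⁻¹ ^ 3 * ‖scale Δ' q₁‖)

/-- **FIRST LEMMA (proved): K_A ⇒ two-level agreement.** Pure algebra over the route decl:
`Q₁S₂ − Q₂S₁ = (Q₁ − S₁V)S₂ − (Q₂ − S₂V)S₁` with the COMMON level-free value
`V = secondMomentForm Δ' P Q + T₂ Δ' P Q`. -/
theorem twoLevelAgreement_of_kA (hA : MomentsBeyondDiagonal) : TwoLevelAgreement := by
  obtain ⟨Δ, hΔ, T₁, T₂, h⟩ := hA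
  refine ⟨Δ, hΔ, fun P Q hP hQ Δ' h1 h2 ↦ ?_⟩
  obtain ⟨C, q₀, H⟩ := h P Q hP hQ Δ' h1 h2
  refine ⟨C, q₀, fun q₁ q₂ _ _ hq₁ hq₂ hle₁ hle₂ hn₁ hn₂ ↦ ?_⟩
  have e₁ := (H q₁ hq₁ hle₁ hn₁).2
  have e₂ := (H q₂ hq₂ hle₂ hn₂).2
  set V : ℂ := ((KMV2000.secondMomentForm Δ' P Q + T₂ Δ' P Q : ℝ) : ℂ) with hV
  set Q₁ : ℂ := QhPQ q₁ P Q (qhat q₁ ^ Δ') with hQ₁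
  set Q₂ : ℂ := QhPQ q₂ P Q (qhat q₂ ^ Δ') with hQ₂
  have hS₁ : scale Δ' q₁ = 2 * riemannZeta 2 ^ 2 *
      ((qhat q₁ / (Δ' ^ 2 * Real.log (qhat q₁) ^ 2) : ℝ) : ℂ) := rfl
  have hS₂ : scale Δ' q₂ = 2 * riemannZeta 2 ^ 2 *
      ((qhat q₂ / (Δ' ^ 2 * Real.log (qhat q₂) ^ 2) : ℝ) : ℂ) := rfl
  have e₁' : ‖Q₁ - scale Δ' q₁ * V‖ ≤ C * qhat q₁ * (Real.log (qhat q₁))⁻¹ ^ 3 := by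
    rw [hS₁]; exact e₁
  have e₂' : ‖Q₂ - scale Δ' q₂ * V‖ ≤ C * qhat q₂ * (Real.log (qhat q₂))⁻¹ ^ 3 := by
    rw [hS₂]; exact e₂
  have key : Q₁ * scale Δ' q₂ - Q₂ * scale Δ' q₁ =
      (Q₁ - scale Δ' q₁ * V) * scale Δ' q₂ - (Q₂ - scale Δ' q₂ * V) * scale Δ' q₁ := by ring
  calc ‖Q₁ * scale Δ' q₂ - Q₂ * scale Δ' q₁‖
      = ‖(Q₁ - scale Δ' q₁ * V) * scale Δ' q₂ - (Q₂ - scale Δ' q₂ * V) * scale Δ' q₁‖ := by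
        rw [key]
    _ ≤ ‖(Q₁ - scale Δ' q₁ * V) * scale Δ' q₂‖ + ‖(Q₂ - scale Δ' q₂ * V) * scale Δ' q₁‖ :=
        norm_sub_le _ _
    _ = ‖Q₁ - scale Δ' q₁ * V‖ * ‖scale Δ' q₂‖ + ‖Q₂ - scale Δ' q₂ * V‖ * ‖scale Δ' q₁‖ := by
        rw [norm_mul, norm_mul]
    _ ≤ (C * qhat q₁ * (Real.log (qhat q₁))⁻¹ ^ 3) * ‖scale Δ' q₂‖ +
        (C * qhat q₂ * (Real.log (qhat q₂))⁻¹ ^ 3) * ‖scale Δ' q₁‖ := by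
        gcongr
    _ = C * (qhat q₁ * (Real.log (qhat q₁))⁻¹ ^ 3 * ‖scale Δ' q₂‖ +
                 qhat q₂ * (Real.log (qhat q₂))⁻¹ ^ 3 * ‖scale Δ' q₁‖) := by ring

/-- «World (A)_A infinitely often» — the antecedent of `Negation.DeepAWorldKillsKA A`, verbatim. -/
def AWorldIO (A : ℕ) : Prop :=
  ∀ D₀ : ℕ, ∃ (D : ℕ) (_ : NeZero D) (χ : DirichletCharacter ℂ D), D₀ ≤ D ∧
    χ.IsPrimitive ∧ MulChar.IsQuadratic χ ∧ ‖χ.LFunction 1‖ ≤ (Real.log D ^ A)⁻¹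

/-- **The line's target (negation lens): HEIGHT SHEAR.** In an (A)_A world, two-level agreement fails:
the illusory evaluation of K_A's object at two heights `λ₁ ≠ λ₂` (levels `q ≍ D^{λ}` in ONE
root-number class `χ_D(−q) = s`) exhibits a located main term whose shape depends on
`r = log D / log q̂`, against a level-free prediction. This decl is the typed conclusion the
analytic stubs of the line must deliver; it is NOT asserted. -/
def HeightShearAt (A : ℕ) : Prop := AWorldIO A → ¬ TwoLevelAgreement

/-- Composition (proved): height shear at depth `A` IS the depth-matched kill at depth `A`. -/
theorem deepKill_of_heightShear {A : ℕ} (h : HeightShearAt A) : DeepAWorldKillsKA A :=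
  fun hW hKA ↦ h hW (twoLevelAgreement_of_kA hKA)

/-- … hence, by the tree kernel, K_A alone would give Zhang's Theorem 1 (route `reduces-to`):
the weakest member `A = 2022` suffices. -/
example (h : HeightShearAt 2022) (hA : MomentsBeyondDiagonal) : Zhang2022.Skeleton.Theorem1 :=
  theorem1_of_kA_of_deepKill le_rfl (deepKill_of_heightShear h) hA

/-- One level's term of the hinge stub: the harmonic second moment of `Λ(f,½)·B(f)` at level `q`
(`0` at the junk level `q = 0`). -/
def levelTerm (L : ℕ) (b : ℕ → ℂ) (q : ℕ) : ℝ :=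
  if hq : q = 0 then 0 else
    haveI : NeZero q := ⟨hq⟩
    ‖GL2Family.harmonicSum q 2 (fun f ↦
        ((‖derivLambda q 0 f *
            ∑ m ∈ Icc 1 L, b m * GL2Family.heckeLambda f m * (((m : ℝ) ^ (-(1 / 2 : ℝ)) : ℝ) : ℂ)‖ ^ 2 :
          ℝ) : ℂ))‖

/-- **Typed hinge stub (statement only): a LEVEL-AVERAGED beyond-diagonal mean value.** For Dirichlet
polynomials `B(f) = ∑_{m ≤ L} b_m λ_f(m) m^{−1/2}`, `L = ⌊Q^{1/2+κ}⌋`, the harmonic second moment of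
`Λ(f,½)·B(f)` SUMMED over all levels `q ∈ [Q, 2Q]` is `≤ C Q^{3/2} (log Q)^{B₁} ∑ |b_m|² τ(m)^4 / m`
(`Q` levels × the completed-value scale `q̂ ≍ √Q` × `polylog`: i.e. NO power loss per level although the
length `L² ≍ Q^{1+2κ}` exceeds every single level).
(Deshouillers–Iwaniec / Iwaniec–Sarnak level-aspect technology; PER LEVEL such a bound is false in
general for `L² > q` by trace/rank — the kill may average over levels because it quantifies `∃ q`.) -/
def LevelAvgMeanValue (κ : ℝ) (B₁ : ℕ) : Prop :=
  ∃ C : ℝ, ∀ Q : ℕ, 2 ≤ Q → ∀ b : ℕ → ℂ,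
    ∑ q ∈ Icc Q (2 * Q), levelTerm ⌊(Q : ℝ) ^ (1 / 2 + κ)⌋₊ b q ≤
      C * (Q : ℝ) ^ (3 / 2 : ℝ) * Real.log Q ^ B₁ *
        ∑ m ∈ Icc 1 ⌊(Q : ℝ) ^ (1 / 2 + κ)⌋₊, ‖b m‖ ^ 2 * ((Nat.divisors m).card : ℝ) ^ 4 / m

end Summit.Parity.GeneralizedHardyLittlewood.Cruxes.MomentsBeyondDiagonal.HeightShear

end
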